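/-
Origin: expansion seat `prover-pub-hodgecm-mc-binder-1-g17-0`, handover #R110r2 2026-08-20T22:31:33Z md5 222707cae27e (254 l.; REPLACE of HodgeCM/Model/TowerInjective.lean — PKG file now 44eb3549dc38 (286 l., incl. packager Origin header); body of record 33eed262dc65 (282 l.) → 222707cae27e; owner binder-1 #R110 (RUN 63); +import Model.LevelPullInjective; §2 trPull_one_injective_of_normal (through Level.core) and trPull_one_injective (ht) (k) := #R121 trPull_one_injective_free — binder h₂ AND the idle hle dropped; §3 restrictLevel_injective/castLevel_injective/translate_injective minus h₂; quotient-datum lemmas levelSubgroup…map_Γ_eq kept verbatim (still take h₂; used only by #R117's kept levelHomeo_smul); NAMES for audit: HodgeCM.Model.TowerInjective.castLevel_injective · HodgeCM.Model.TowerInjective.translate_injective · HodgeCM.Model.TowerInjective.trPull_one_injective) (`HOME/mc/pub-hodgecm-mc-binder-1-g17/campaign/new/TowerInjective.lean`, md5 222707cae27e, 254 lines);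
landed by the gen-27 packager (p-g27) in gate run 65 REPLACES the earlier landed copy of `HodgeCM/Model/TowerInjective.lean` (verbatim).
-/
/-
Copyright (c) 2026 the pub-hodgecm formalisation cell (harness21).  New file, not vendored.
Origin: session prover-pub-hodgecm-mc-binder-1-g16-0 (unit pub-hodgecm-mc-binder-1-g16, BINDER PROVER gen 16 of lineage mc-binder-1;
content lane (J-Liu-Θ), (J3) design memo `HOME/mc/pub-hodgecm-mc-axioms-1-g15/J3-DESIGN.md` §3, HECKE-TOWER sub-leaf (T4)-lite
«the transition maps of the tower are injective»), 2026-08-20.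
-/
import Summits.HodgeConjecture.HodgeCM.Model.TowerLevel_2
import Summits.HodgeConjecture.HodgeCM.Model.HeckeClassLiftModel
import Summits.HodgeConjecture.HodgeCM.Model.LevelPullInjective

/-!
# The transition maps `H_K → H_{K'}` of the tower are injective (finite level coverings)

For levels `Δ' ≤ Δ` of one hermitian space the pull-back along the level covering `X_{Δ'} ⟶ X_Δ` is injective on
`Hᵏ(X_Δ(ℂ); ℂ)` (a finite covering of compact manifolds: transfer).  At the model this is #R95/#R96/#R99
(`LevelCoverAlgebraic.levelHomeo`, `HeckeHodgeType.pull_baseChange_injective`, `HeckeAdmissible.isCoveringMap_levelProj_of_levelModel`)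
applied to the ball-QUOTIENT datum of `P_Δ` ((ii-b) `h₂`, #R101 `modelQuotientDatum`) and the level model `(X_{Δ'}, ballDatum Δ')` —
first for `Δ'.Γ ⊴ Δ.Γ` of finite index (`trPull_one_injective_of_normal`), then for every `Δ' ≤ Δ` through the NORMAL CORE LEVEL
`Level.core Δ Δ'` (vendored `Subgroup.levelCore` over the arithmetic group, compact open by `isCompact_levelCore`/`isOpen_levelCore`;
`t^*_{Δ''→Δ} = t^*_{Δ''→Δ'} ∘ t^*_{Δ'→Δ}`).

Consequences for the tower (#R108/#R109): `restrictLevel`, `castLevel`, `translate` are injective; hence (next leaf) `ofLevel : H_K → H` is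
injective and the identity-component restriction `res Γ : H → H¹(P_Γ; ℂ)` is well defined on the image of `H_K`.
Hypotheses: the universe's `hHD hI hU h₃`, Arapura `hA` (behind every translate) — all records already of the cell; nothing minted.

**(iib-T) re-cut (binder-1-g17):** the injectivity theorems of §2–§3 (`trPull_one_injective_of_normal`, `trPull_one_injective`,
`restrictLevel_injective`, `castLevel_injective`, `translate_injective`) NO LONGER take `h₂ : SpecialCyclesAlgebraic`: they are derived from
`Model/LevelPullInjective.lean` (`trPull_one_injective_free`: the (ii-b)-free finite-cover theorem `isFiniteCover_levelCover` + the normalised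
transfer).  The quotient-datum lemmas of §2 (`levelSubgroup` … `map_Γ_eq`), which do take `h₂`, are kept verbatim for `Model/TowerTransfer`'s
`levelHomeo_smul`; nothing on the path to `res`/`LiuDictionary.ofTower` uses them any more.
-/

noncomputable section

open scoped Matrix
open Matrix Function Set
open NumberField CategoryTheory
open Literature.AlgebraicGeometry.Motives
open Literature.AlgebraicGeometry.ShimuraVarieties
open Literature.AlgebraicGeometry.HodgeTheory
open Literature.NumberTheory.Automorphic
open Literature.NumberTheory.Automorphic.PicardCM
open Literature.NumberTheory.Transcendental (Arapura2012_Cor_15_4_6)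

namespace HodgeCM

/-! ## 1. The normal core level `Level.core Δ Δ'` of `Δ' ≤ Δ` -/

namespace Level

variable {L : CMField} {ι₁ : L →+* ℂ} {V : HermSpace3 L ι₁}

/-- The diagonal `Δ.Γ →* U(V)(𝔸_f)` (vendored `levelEmb` on the arithmetic group of the level). -/
abbrev emb (Δ : Level V) : ↥Δ.Γ →* ↥V.adelicFin :=
  UnitaryGroup.levelEmb (F := ↥(maximalRealSubfield L)) (E := (L : Type)) (c := IsCMField.complexConj L) (N := 3) (J := V.Hm)
    Δ.Γ_le_rational

/-- For `Δ' ≤ Δ`: `Δ'.Γ` has finite index in `Δ.Γ` (`K'` is open in the compact `K`, and `Δ.Γ/Δ'.Γ ↪ K/K'`). -/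
theorem finiteIndex_comap_emb (Δ Δ' : Level V) : (Δ'.K.comap Δ.emb).FiniteIndex := by
  haveI : (Δ'.K.subgroupOf Δ.K).FiniteIndex := by
    haveI : CompactSpace Δ.K := isCompact_iff_compactSpace.mp Δ.isCompact_K
    haveI : DiscreteTopology (Δ.K ⧸ Δ'.K.subgroupOf Δ.K) :=
      QuotientGroup.discreteTopology (Δ'.isOpen_K.preimage continuous_subtype_val)
    haveI : Finite (Δ.K ⧸ Δ'.K.subgroupOf Δ.K) := finite_of_compact_of_discrete
    exact Subgroup.finiteIndex_of_finite_quotient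
  have h := UnitaryGroup.comap_levelEmb (F := ↥(maximalRealSubfield L)) (E := (L : Type)) (c := IsCMField.complexConj L) (N := 3)
    (J := V.Hm) Δ.Γ_le_rational Δ'.K
  rw [emb, h, ← Δ.arithmeticLevel_K, UnitaryGroup.arithmeticLevel_subgroupOf]
  exact Subgroup.finiteIndex_comap_of_finiteIndex _ _

/-- `Δ'.Γ ∩ Δ.Γ` has finite index in `Δ.Γ` (any two levels). -/
theorem finiteIndex_subgroupOf (Δ Δ' : Level V) : (Δ'.Γ.subgroupOf Δ.Γ).FiniteIndex := by
  have h := finiteIndex_comap_emb Δ Δ'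
  have e : Δ'.K.comap Δ.emb = Δ'.Γ.subgroupOf Δ.Γ := by
    have h' := UnitaryGroup.comap_levelEmb (F := ↥(maximalRealSubfield L)) (E := (L : Type)) (c := IsCMField.complexConj L) (N := 3)
      (J := V.Hm) Δ.Γ_le_rational Δ'.K
    rw [emb, h', Δ'.arithmeticLevel_K]
  rwa [e] at h

/-- **The normal core level** of `Δ' ≤ Δ`: `K'' = ⋂_{γ ∈ Δ.Γ} γ_f K' γ_f⁻¹` (vendored `Subgroup.levelCore`), compact open, `≤ K'`, with
arithmetic group normalised by `Δ.Γ`. -/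
def core (Δ Δ' : Level V) : Level V where
  Γ := UnitaryGroup.arithmeticLevel (↥(maximalRealSubfield L)) L (IsCMField.complexConj L) 3 V.Hm (Subgroup.levelCore Δ.emb Δ'.K)
  K := Subgroup.levelCore Δ.emb Δ'.K
  isCompact_K := by
    haveI := finiteIndex_comap_emb Δ Δ'
    exact Subgroup.isCompact_levelCore _ _ Δ'.isCompact_K Δ'.isOpen_K
  isOpen_K := by
    haveI := finiteIndex_comap_emb Δ Δ'
    exact Subgroup.isOpen_levelCore _ _ Δ'.isOpen_K
  arithmeticLevel_K := rfl
  torsionFree γ hγ hfin := by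
    have hγ' : γ ∈ Δ'.Γ := by
      rw [← Δ'.arithmeticLevel_K]
      exact UnitaryGroup.arithmeticLevel_mono (Subgroup.levelCore_le _ _) hγ
    exact Δ'.torsionFree γ hγ' hfin

/-- (Ported verbatim from the HodgeCMPerL package; no docstring in the source.) -/
theorem core_le (Δ Δ' : Level V) : core Δ Δ' ≤ Δ' := Subgroup.levelCore_le _ _

/-- (Ported verbatim from the HodgeCMPerL package; no docstring in the source.) -/
theorem core_le' {Δ Δ' : Level V} (hle : Δ' ≤ Δ) : core Δ Δ' ≤ Δ := (core_le Δ Δ').trans hle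

/-- `(core Δ Δ').Γ` is normalised by `Δ.Γ`. -/
theorem conj_mem_core_Γ (Δ Δ' : Level V) {δ x : GL (Fin 3) L} (hδ : δ ∈ Δ.Γ) (hx : x ∈ (core Δ Δ').Γ) :
    δ * x * δ⁻¹ ∈ (core Δ Δ').Γ := by
  obtain ⟨hxU, hxK⟩ := UnitaryGroup.mem_arithmeticLevel_iff.mp hx
  have hδU := Δ.Γ_le_rational hδ
  have hU : δ * x * δ⁻¹ ∈ UnitaryGroup.rational (↥(maximalRealSubfield L)) L (IsCMField.complexConj L) 3 V.Hm :=
    Subgroup.mul_mem _ (Subgroup.mul_mem _ hδU hxU) (Subgroup.inv_mem _ hδU)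
  refine UnitaryGroup.mem_arithmeticLevel_iff.mpr ⟨hU, ?_⟩
  have key := Subgroup.conj_mem_levelCore Δ.emb Δ'.K hxK ⟨δ, hδ⟩
  have e : (⟨δ * x * δ⁻¹, hU⟩ : UnitaryGroup.rational (↥(maximalRealSubfield L)) L (IsCMField.complexConj L) 3 V.Hm) =
      ⟨δ, hδU⟩ * ⟨x, hxU⟩ * ⟨δ, hδU⟩⁻¹ := rfl
  rw [e, map_mul, map_mul, map_inv]
  exact key

/-- `(core Δ Δ').Γ ⊴ Δ.Γ`. -/
theorem normal_core_subgroupOf (Δ Δ' : Level V) : ((core Δ Δ').Γ.subgroupOf Δ.Γ).Normal :=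
  ⟨fun _ hx δ ↦ conj_mem_core_Γ Δ Δ' δ.2 hx⟩

/-- (Ported verbatim from the HodgeCMPerL package; no docstring in the source.) -/
theorem BelowConjThree.core {Δ Δ' : Level V} (hΔ' : Δ'.BelowConjThree) : (core Δ Δ').BelowConjThree :=
  hΔ'.of_le (core_le Δ Δ')

end Level

/-! ## 2. Injectivity of the pull-back along a NORMAL level covering, at the model -/

namespace Model.TowerInjective

open HodgeCM.Model.LevelTranslate HodgeCM.Model.TowerLevel HodgeCM.Model.HeckeAdmissible HodgeCM.Model.HeckeHodgeType

variable (hHD : exists_isReal_hodgeModel) (hI : hodgePQ_independent_of_hodgeModel)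
  (hU : BallQuotientUniformisedDatum) (h₃ : CMAbelianVarietyRealised) (hA : Arapura2012_Cor_15_4_6) (h₂ : SpecialCyclesAlgebraic)
variable {L : CMField} {ι₁ : L →+* ℂ} {V : HermSpace3 L ι₁}

/-- The subgroup of the quotient datum's `Γ` cut out by `Δ'.Γ` (through `τ₁`/`ι₁` in `GL₃(ℂ)`). -/
def levelSubgroup (Δ Δ' : Level V) (hV : IsAnisotropic L V.Hm) :
    Subgroup ↥(modelQuotientDatum (hHD := hHD) (hI := hI) (hU := hU) (h₃ := h₃) h₂ L ι₁ V Δ hV).Γ :=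
  (Δ'.Γ.map (Matrix.GeneralLinearGroup.map ι₁)).comap
    ((Matrix.GeneralLinearGroup.map (modelQuotientDatum (hHD := hHD) (hI := hI) (hU := hU) (h₃ := h₃) h₂ L ι₁ V Δ hV).τ₁).comp
      (modelQuotientDatum (hHD := hHD) (hI := hI) (hU := hU) (h₃ := h₃) h₂ L ι₁ V Δ hV).Γ.subtype)

variable {Δ Δ' : Level V}

/-- (Ported verbatim from the HodgeCMPerL package; no docstring in the source.) -/
theorem mem_levelSubgroup_iff (hV : IsAnisotropic L V.Hm)
    (δ : ↥(modelQuotientDatum (hHD := hHD) (hI := hI) (hU := hU) (h₃ := h₃) h₂ L ι₁ V Δ hV).Γ) :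
    δ ∈ levelSubgroup hHD hI hU h₃ h₂ Δ Δ' hV ↔
      Matrix.GeneralLinearGroup.map (modelQuotientDatum (hHD := hHD) (hI := hI) (hU := hU) (h₃ := h₃) h₂ L ι₁ V Δ hV).τ₁
        (δ : GL (Fin 3) _) ∈ Δ'.Γ.map (Matrix.GeneralLinearGroup.map ι₁) :=
  Iff.rfl

/-- The image of the quotient datum's `Γ` in `GL₃(ℂ)` is `Δ.Γ^{ι₁}`. -/
theorem range_eq (hV : IsAnisotropic L V.Hm) :
    ((Matrix.GeneralLinearGroup.map (modelQuotientDatum (hHD := hHD) (hI := hI) (hU := hU) (h₃ := h₃) h₂ L ι₁ V Δ hV).τ₁).comp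
      (modelQuotientDatum (hHD := hHD) (hI := hI) (hU := hU) (h₃ := h₃) h₂ L ι₁ V Δ hV).Γ.subtype).range =
      Δ.Γ.map (Matrix.GeneralLinearGroup.map ι₁) := by
  rw [MonoidHom.range_comp, Subgroup.range_subtype]
  exact ballDatum_map_Γ hU h₃ Δ ((isAnisotropic_pmsCode_iff L ι₁ V Δ).2 hV)

/-- `GL₃(ι₁)` is injective. -/
theorem glι_injective : Function.Injective (Matrix.GeneralLinearGroup.map (n := Fin 3) ι₁) := fun _ _ h ↦
  Units.ext (Matrix.map_injective ι₁.injective (congrArg Units.val h))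

/-- (Ported verbatim from the HodgeCMPerL package; no docstring in the source.) -/
theorem normal_levelSubgroup (hV : IsAnisotropic L V.Hm) (hN : (Δ'.Γ.subgroupOf Δ.Γ).Normal) :
    (levelSubgroup hHD hI hU h₃ h₂ Δ Δ' hV).Normal := by
  refine ⟨fun n hn δ ↦ ?_⟩
  rw [mem_levelSubgroup_iff] at hn ⊢
  have hrange : ∀ x : ↥(modelQuotientDatum (hHD := hHD) (hI := hI) (hU := hU) (h₃ := h₃) h₂ L ι₁ V Δ hV).Γ,
      Matrix.GeneralLinearGroup.map (modelQuotientDatum (hHD := hHD) (hI := hI) (hU := hU) (h₃ := h₃) h₂ L ι₁ V Δ hV).τ₁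
        (x : GL (Fin 3) _) ∈ Δ.Γ.map (Matrix.GeneralLinearGroup.map ι₁) := fun x ↦ by
    rw [← range_eq hHD hI hU h₃ h₂ hV]; exact ⟨x, rfl⟩
  obtain ⟨d, hd, hde⟩ := Subgroup.mem_map.mp (hrange δ)
  obtain ⟨m, hm, hme⟩ := Subgroup.mem_map.mp hn
  have hmΔ : m ∈ Δ.Γ := by
    obtain ⟨m', hm', hme'⟩ := Subgroup.mem_map.mp (hrange n)
    rwa [← glι_injective (hme'.trans hme.symm)]
  have key : d * m * d⁻¹ ∈ Δ'.Γ := by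
    have h := hN.conj_mem ⟨m, hmΔ⟩ (Subgroup.mem_subgroupOf.mpr hm) ⟨d, hd⟩
    exact Subgroup.mem_subgroupOf.mp h
  have e : Matrix.GeneralLinearGroup.map (modelQuotientDatum (hHD := hHD) (hI := hI) (hU := hU) (h₃ := h₃) h₂ L ι₁ V Δ hV).τ₁
      ((δ * n * δ⁻¹ : ↥(modelQuotientDatum (hHD := hHD) (hI := hI) (hU := hU) (h₃ := h₃) h₂ L ι₁ V Δ hV).Γ) : GL (Fin 3) _) =
      Matrix.GeneralLinearGroup.map ι₁ (d * m * d⁻¹) := by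
    rw [map_mul, map_mul, map_inv, hde, hme, Subgroup.coe_mul, Subgroup.coe_mul, InvMemClass.coe_inv, map_mul, map_mul, map_inv]
  rw [e]
  exact Subgroup.mem_map_of_mem _ key

/-- (Ported verbatim from the HodgeCMPerL package; no docstring in the source.) -/
theorem finiteIndex_levelSubgroup (hV : IsAnisotropic L V.Hm) :
    (levelSubgroup hHD hI hU h₃ h₂ Δ Δ' hV).FiniteIndex := by
  rw [Subgroup.finiteIndex_iff, levelSubgroup, Subgroup.index_comap, range_eq hHD hI hU h₃ h₂ hV,
    Subgroup.relIndex_map_map_of_injective _ _ glι_injective]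
  exact Subgroup.finiteIndex_iff.mp (Level.finiteIndex_subgroupOf Δ Δ')

/-- The `hΓ` clause of the level model `(X_{Δ'}, ballDatum Δ')` for the subgroup `levelSubgroup`: both sides are `Δ'.Γ^{ι₁}`. -/
theorem map_Γ_eq (hV : IsAnisotropic L V.Hm) (hle : Δ' ≤ Δ) :
    (Var.ballDatum hU h₃ (pmsCode L ι₁ V Δ') ((isAnisotropic_pmsCode_iff L ι₁ V Δ').2 hV)).Γ.map
        (Matrix.GeneralLinearGroup.map (Var.ballDatum hU h₃ (pmsCode L ι₁ V Δ') ((isAnisotropic_pmsCode_iff L ι₁ V Δ').2 hV)).τ₁) =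
      ((levelSubgroup hHD hI hU h₃ h₂ Δ Δ' hV).map
          (modelQuotientDatum (hHD := hHD) (hI := hI) (hU := hU) (h₃ := h₃) h₂ L ι₁ V Δ hV).Γ.subtype).map
        (Matrix.GeneralLinearGroup.map (modelQuotientDatum (hHD := hHD) (hI := hI) (hU := hU) (h₃ := h₃) h₂ L ι₁ V Δ hV).τ₁) := by
  rw [ballDatum_map_Γ hU h₃ Δ' ((isAnisotropic_pmsCode_iff L ι₁ V Δ').2 hV), Subgroup.map_map, levelSubgroup, Subgroup.map_comap_eq,
    range_eq hHD hI hU h₃ h₂ hV, eq_comm, inf_eq_right]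
  exact Subgroup.map_mono (Level.Γ_mono hle)

/-- **Injectivity through the NORMAL CORE level** `Level.core Δ Δ' ≤ Δ` ((core).Γ ⊴ Δ.Γ, finite index): `t_1^* : Hᵏ(X_Δ) → Hᵏ(X_{core})` is
injective — now a special case of `LevelPullInjective.trPull_one_injective_free` ((ii-b)-free). -/
theorem trPull_one_injective_of_normal (hle : Δ' ≤ Δ) (k : ℕ) :
    Injective (trPull hHD hI hU h₃ hA 1 (Level.core Δ Δ') Δ (transCond_one_of_le (Level.core_le' hle)) k) :=
  LevelPullInjective.trPull_one_injective_free hHD hI hU h₃ hA _ k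

/-- **Injectivity of the transition maps of the tower**: for every `Δ' ≤ Δ` (as `TransCond 1 Δ' Δ`),
`t_1^* : Hᵏ(X_Δ(ℂ); ℂ) → Hᵏ(X_{Δ'}(ℂ); ℂ)` is injective ((ii-b)-free: `LevelPullInjective.trPull_one_injective_free` — the level covering is a
finite covering, and the normalised transfer is a retraction of its pull-back). -/
theorem trPull_one_injective (ht : TransCond ((1 : ↥(Urat V)) : GL (Fin 3) L) Δ' Δ) (k : ℕ) :
    Injective (trPull hHD hI hU h₃ hA 1 Δ' Δ ht k) :=
  LevelPullInjective.trPull_one_injective_free hHD hI hU h₃ hA ht k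

/-! ## 3. Consequences for `H_K` -/

/-- `restrictLevel : H_K → H_{K'}` is injective. -/
theorem restrictLevel_injective {Γ Γ' : Level V} (hle : Γ' ≤ Γ) (hΓ : Γ.BelowConjThree)
    (hΓ' : Γ'.BelowConjThree) : Injective (restrictLevel hHD hI hU h₃ hA hle hΓ hΓ') := by
  intro c d hcd
  apply Subtype.ext; funext h
  have hh := congrArg (fun e : towerLevel hHD hI hU h₃ hA Γ' hΓ' ↦ (e : Π h, W hHD hI hU h₃ Γ' hΓ' h) h) hcd
  simp only [restrictLevel_apply] at hh
  exact trPull_one_injective hHD hI hU h₃ hA _ 1 hh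

/-- `castLevel` is injective. -/
theorem castLevel_injective {Γ₁ Γ₂ : Level V} (e : Γ₁ = Γ₂) (hΓ₁ : Γ₁.BelowConjThree)
    (hΓ₂ : Γ₂.BelowConjThree) : Injective (castLevel hHD hI hU h₃ hA e hΓ₁ hΓ₂) :=
  restrictLevel_injective hHD hI hU h₃ hA e.symm.le hΓ₁ hΓ₂

/-- `translate g : H_K → H_{gKg⁻¹}` is injective (left inverse: `translate g⁻¹` followed by the `castLevel` of `Γ.conj (g⁻¹ g) = Γ`). -/
theorem translate_injective {Γ : Level V} (hΓ : Γ.BelowConjThree) (g : V.adelicFin) :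
    Injective (TowerLevel.translate hHD hI hU h₃ hA hΓ g) := by
  intro c d hcd
  have h := congrArg (TowerLevel.translate hHD hI hU h₃ hA (hΓ.conj g) g⁻¹) hcd
  rw [← translate_mul, ← translate_mul] at h
  have h' := castLevel_injective hHD hI hU h₃ hA _ _ _ h
  have e : Γ.conj (g⁻¹ * g) hΓ = Γ := by rw [inv_mul_cancel, Level.conj_one]
  have key : ∀ c : towerLevel hHD hI hU h₃ hA Γ hΓ,
      castLevel hHD hI hU h₃ hA e (hΓ.conj (g⁻¹ * g)) hΓ (TowerLevel.translate hHD hI hU h₃ hA hΓ (g⁻¹ * g) c) = c := by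
    intro c
    have : ∀ (g₀ : V.adelicFin) (e₀ : 1 = g₀) (e' : Γ.conj g₀ hΓ = Γ),
        castLevel hHD hI hU h₃ hA e' (hΓ.conj g₀) hΓ (TowerLevel.translate hHD hI hU h₃ hA hΓ g₀ c) = c := by
      intro g₀ e₀ e'; subst e₀; exact translate_one hHD hI hU h₃ hA hΓ c
    exact this (g⁻¹ * g) (inv_mul_cancel g).symm e
  have h'' := congrArg (castLevel hHD hI hU h₃ hA e (hΓ.conj (g⁻¹ * g)) hΓ) h'
  rwa [key c, key d] at h''

end Model.TowerInjective

end HodgeCM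

end
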